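import Summits.QuantumFields.BalabanUV.T4Continuum.E3Cert.ZL2d2AllU.Data
/-! E3 certificate package `ZL2d2AllU` — module `S1` ((2,2,1) block, d = 2, all-U, γ = 1021∕1024; emitter `bal_e3_lean_emit.py` output for
`abs_L2d2_allU.json`, lane `run/shared/lean/ttrl/balaban-calc/e3/lean-draft/tree/zL2d2AllU/S1.lean`; TREE COPY by the substrate cell E3 PILOT, typer
ruling (μ3), journal l.19196: import prefix substituted and one-line docstrings added BY SCRIPT, no literal touched).  Meaning of the certificate:
see `Data.lean` ∕ `Main.lean` of this package and the checker `E3Cert/E3PolyCertZ*.lean`.  HONEST: certified computation on ONE small block —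
NOT Prop. (1.8), NOT an input of any NE row today, NOT infinite volume ∕ mass gap ∕ Clay. -/
set_option maxRecDepth 200000
set_option maxHeartbeats 0
namespace E3Z
/-- E3 certificate `zL2d2AllU` component: `zL2d2AllU_sl8` (lane output, transcribed verbatim; see the module docstring). -/
theorem zL2d2AllU_sl8 : GramCert.mainSlice zL2d2AllU 8 = true := by
  decide +kernel
/-- E3 certificate `zL2d2AllU` component: `zL2d2AllU_sl9` (lane output, transcribed verbatim; see the module docstring). -/
theorem zL2d2AllU_sl9 : GramCert.mainSlice zL2d2AllU 9 = true := by
  decide +kernel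
/-- E3 certificate `zL2d2AllU` component: `zL2d2AllU_sl10` (lane output, transcribed verbatim; see the module docstring). -/
theorem zL2d2AllU_sl10 : GramCert.mainSlice zL2d2AllU 10 = true := by
  decide +kernel
/-- E3 certificate `zL2d2AllU` component: `zL2d2AllU_sl11` (lane output, transcribed verbatim; see the module docstring). -/
theorem zL2d2AllU_sl11 : GramCert.mainSlice zL2d2AllU 11 = true := by
  decide +kernel
/-- E3 certificate `zL2d2AllU` component: `zL2d2AllU_sl12` (lane output, transcribed verbatim; see the module docstring). -/
theorem zL2d2AllU_sl12 : GramCert.mainSlice zL2d2AllU 12 = true := by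
  decide +kernel
/-- E3 certificate `zL2d2AllU` component: `zL2d2AllU_sl13` (lane output, transcribed verbatim; see the module docstring). -/
theorem zL2d2AllU_sl13 : GramCert.mainSlice zL2d2AllU 13 = true := by
  decide +kernel
/-- E3 certificate `zL2d2AllU` component: `zL2d2AllU_sl14` (lane output, transcribed verbatim; see the module docstring). -/
theorem zL2d2AllU_sl14 : GramCert.mainSlice zL2d2AllU 14 = true := by
  decide +kernel
/-- E3 certificate `zL2d2AllU` component: `zL2d2AllU_sl15` (lane output, transcribed verbatim; see the module docstring). -/
theorem zL2d2AllU_sl15 : GramCert.mainSlice zL2d2AllU 15 = true := by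
  decide +kernel
end E3Z
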